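import Summits.HubbardSuperconductivity.HubbardSuperconductivity.Theorems.BalabanIRBirComplexStableXYRStubFatGaussianDomination
import Literature.MathematicalPhysics.QuantumFieldTheory.TorusChartCochains
import HarnessLib

/-!
# Route `BalabanIR`, crux `BirComplexStableXYR` (item `stmt-HubbardSuperconductivity-14845`),
# line `fat-gaussian-defect-calculus`: stub H8 `stub_sectorModulusFat`

Helper (`--supports`) for the crux
`Summit.HubbardSuperconductivity.HubbardSuperconductivity.Theses.BalabanIR.BirComplexStableXYR`,
line `fat-gaussian-defect-calculus` (lead skeleton `Cruxes/BirComplexStableXYR/Lines/fat_gaussian_defect_calculus.lean`),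
stub H8 `stub_sectorModulusFat`: **the Gaussian vortex prefactor of the R9 sector representation is exactly
compensated by the growth of the local factors; what is left is the periodic fat Gaussian.**

**Statement.** On the space–time torus `Λ L M` (chart `TorusChart.piProdZMod 2 L M`), for a window table
`c : Table r` satisfying the coercivity (C) `c₀ ΣΣ (1 − cos(φ_w − φ_w')) ≤ Re F(φ)` (`F = genF c`, `c₀ ≥ 0`) and
`K ≥ 0`, let `P ω s` be the window path configurations of a real `1`-cochain `ω` (hypothesis `hP`), `Q` the
window Hessian form (hypothesis `hQ`), `𝒬(ω) = Σ_s Q (P ω s)` the thin form, and let the strain `σ` satisfy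
Pythagoras `𝒬(d₀u − σ) = 𝒬(d₀u) + 𝒬(σ)` for all real fields `u`.  Then for every `u`, writing `ψ_s = P (d₀u − σ) s`,

  `‖e^{−(K/2)𝒬(σ)} · (e^{−(K/2)𝒬(d₀u)} · Π_s exp(−K F(ψ_s) + (K/2) Q(ψ_s)))‖`
    `≤ exp(−(2c₀K/π²) Σ_s ΣΣ_{w,w'} pv(ψ_s w − ψ_s w')²)`,

`pv = toIocMod two_pi_pos (−π)` the principal value in `(−π, π]`.

**Proof.** `‖·‖` is multiplicative (`norm_mul`, `norm_prod`), `‖exp z‖ = exp (Re z)` (`Complex.norm_exp`), so the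
two real prefactors have modulus `exp(−(K/2)𝒬(σ))`, `exp(−(K/2)𝒬(d₀u))`, and each local factor splits
(`Complex.exp_add`) as `‖exp(−K F(ψ_s))‖ · exp((K/2) Q(ψ_s))`; the first factor is bounded window-wise by the landed
fat-Gaussian domination S2 (`FatGaussian.stub_fatGaussianDomination`).  Multiplying (`Finset.prod_le_prod`,
`Real.exp_sum`), the exponents of the `Q`-terms cancel exactly by Pythagoras:
`−(K/2)𝒬(σ) − (K/2)𝒬(d₀u) + (K/2) Σ_s Q(ψ_s) = 0`.  The abstract finite-product core is `hsc_modulusCore`; the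
defining hypotheses `hP`, `hQ` are not used.  Elementary; no definition and no named fact is introduced; sorry-free.
[folklore]
-/

set_option linter.dupNamespace false -- `Summit.<S>.<S>.Theorems…` repeats the summit name (D-0017 layout)

namespace Summit.HubbardSuperconductivity.HubbardSuperconductivity.Theorems.FSUnfolding

open scoped BigOperators ComplexConjugate
open Literature.MathematicalPhysics.QuantumFieldTheory Literature.Probability.LatticeModels
open Summit.HubbardSuperconductivity.BirComplexStableXYNegative

/-- **Abstract core of `stub_sectorModulusFat`.**  If every local factor satisfies
`‖exp(−K G_s)‖ ≤ exp(−κ T_s)` and the real exponents satisfy Pythagoras `Σ_s q_s = B + A`, then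
`‖e^{−(K/2)A} (e^{−(K/2)B} Π_s exp(−K G_s + (K/2) q_s))‖ ≤ exp(−κ Σ_s T_s)`: the moduli multiply, each factor
splits as `‖exp(−K G_s)‖ · exp((K/2) q_s)`, and the `q`-exponents cancel the two prefactors exactly. [folklore] -/
theorem hsc_modulusCore {S : Type*} [Fintype S] (K A B κ : ℝ) (G : S → ℂ) (q T : S → ℝ)
    (hG : ∀ s : S, ‖Complex.exp (-((K : ℂ) * G s))‖ ≤ Real.exp (-κ * T s))
    (hpy : ∑ s, q s = B + A) :
    ‖Complex.exp (-(((K / 2 * A) : ℝ) : ℂ)) * (Complex.exp (-(((K / 2 * B) : ℝ) : ℂ)) *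
      ∏ s, Complex.exp (-((K : ℂ) * G s) + (((K / 2 * q s) : ℝ) : ℂ)))‖ ≤ Real.exp (-κ * ∑ s, T s) := by
  rw [norm_mul, norm_mul, norm_prod, Complex.norm_exp, Complex.norm_exp]
  simp only [Complex.neg_re, Complex.ofReal_re]
  -- each local factor splits: `‖exp(−K G_s + (K/2) q_s)‖ = ‖exp(−K G_s)‖ · exp((K/2) q_s)`
  have hfac : ∀ s : S, ‖Complex.exp (-((K : ℂ) * G s) + (((K / 2 * q s) : ℝ) : ℂ))‖
      = ‖Complex.exp (-((K : ℂ) * G s))‖ * Real.exp (K / 2 * q s) := by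
    intro s
    rw [Complex.exp_add, norm_mul, Complex.norm_exp (((K / 2 * q s : ℝ) : ℂ)), Complex.ofReal_re]
  -- window-wise domination, multiplied up
  have hle : ∏ s, ‖Complex.exp (-((K : ℂ) * G s) + (((K / 2 * q s) : ℝ) : ℂ))‖
      ≤ ∏ s, (Real.exp (-κ * T s) * Real.exp (K / 2 * q s)) := by
    refine Finset.prod_le_prod (fun s _ => norm_nonneg _) fun s _ => ?_
    rw [hfac s]
    exact mul_le_mul_of_nonneg_right (hG s) (Real.exp_pos _).le
  have hprod : ∏ s, (Real.exp (-κ * T s) * Real.exp (K / 2 * q s))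
      = Real.exp (-κ * ∑ s, T s) * Real.exp (K / 2 * (B + A)) := by
    rw [Finset.prod_mul_distrib, ← hpy, Finset.mul_sum, Finset.mul_sum, Real.exp_sum, Real.exp_sum]
  -- the `q`-exponents cancel the two prefactors exactly (Pythagoras)
  have hcancel : Real.exp (-(K / 2 * A)) * Real.exp (-(K / 2 * B)) * Real.exp (K / 2 * (B + A)) = 1 := by
    rw [← Real.exp_add, ← Real.exp_add, show -(K / 2 * A) + -(K / 2 * B) + K / 2 * (B + A) = 0 by ring,
      Real.exp_zero]
  calc Real.exp (-(K / 2 * A)) * (Real.exp (-(K / 2 * B)) *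
          ∏ s, ‖Complex.exp (-((K : ℂ) * G s) + (((K / 2 * q s) : ℝ) : ℂ))‖)
        ≤ Real.exp (-(K / 2 * A)) * (Real.exp (-(K / 2 * B)) *
          ∏ s, (Real.exp (-κ * T s) * Real.exp (K / 2 * q s))) :=
        mul_le_mul_of_nonneg_left (mul_le_mul_of_nonneg_left hle (Real.exp_pos _).le) (Real.exp_pos _).le
    _ = (Real.exp (-(K / 2 * A)) * Real.exp (-(K / 2 * B)) * Real.exp (K / 2 * (B + A)))
          * Real.exp (-κ * ∑ s, T s) := by rw [hprod]; ring
    _ = Real.exp (-κ * ∑ s, T s) := by rw [hcancel, one_mul]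

/-- **Stub H8 `stub_sectorModulusFat` (registered signature, verbatim): the Gaussian vortex prefactor is exactly
compensated; what is left is the periodic fat Gaussian.**  For ANY strain `σ` with the Pythagoras property and any
real field `u`, the modulus of the full R9 sector integrand (prefactor `e^{−(K/2)𝒬(σ)}`, thin Gaussian
`e^{−(K/2)𝒬(d₀u)}`, local factors `Π_s R_s(P_s(d₀u − σ))`, `R_s(ψ) = exp(−K genF c ψ + (K/2) Q ψ)`) is at most the
FAT-Gaussian weight `exp(−(2c₀K/π²)·Σ_s ΣΣ pv((P_s(d₀u−σ))_w − (P_s(d₀u−σ))_{w'})²)` of `d₀u − σ`: the landed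
fat-Gaussian domination S2 (`FatGaussian.stub_fatGaussianDomination`) window-wise, and
`Σ_s Q(P_s(d₀u − σ)) = 𝒬(d₀u) + 𝒬(σ)` cancels the Gaussian exponents exactly (`hsc_modulusCore`). [folklore] -/
theorem stub_sectorModulusFat :
    ∀ (r : ℕ) (K : ℝ) (c : Table r) (c₀ : ℝ), 0 ≤ c₀ → 0 ≤ K →
      (∀ φ : W r → ℝ, c₀ * ∑ w, ∑ w', (1 - Real.cos (φ w - φ w')) ≤ (genF c φ).re) →
      ∀ (L M : ℕ) [NeZero L] [NeZero M]
      (P : (Λ L M → Fin 3 → ℝ) → Λ L M → W r → ℝ),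
      (∀ (ω : Λ L M → Fin 3 → ℝ) (s : Λ L M) (w : W r), P ω s w =
        (TorusChart.piProdZMod 2 L M).lineSum ω 0 (w.1 : ℕ) s
          + (TorusChart.piProdZMod 2 L M).lineSum ω 1 (w.2.1 : ℕ) (s + (w.1 : ℕ) • (TorusChart.piProdZMod 2 L M).gen 0)
          + (TorusChart.piProdZMod 2 L M).lineSum ω 2 (w.2.2 : ℕ)
            (s + (w.1 : ℕ) • (TorusChart.piProdZMod 2 L M).gen 0 + (w.2.1 : ℕ) • (TorusChart.piProdZMod 2 L M).gen 1)) →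
      ∀ (Q : (W r → ℝ) → ℝ),
      (∀ u : W r → ℝ, Q u = (-c.sum (fun n a => a * (((∑ w, (n w : ℝ) * u w) ^ 2 : ℝ) : ℂ))).re) →
      ∀ (σ : Λ L M → Fin 3 → ℝ),
        (∀ u : Λ L M → ℝ,
          ∑ s : Λ L M, Q (P (fun x i => (TorusChart.piProdZMod 2 L M).d₀ u x i - σ x i) s) =
            ∑ s : Λ L M, Q (P ((TorusChart.piProdZMod 2 L M).d₀ u) s) + ∑ s : Λ L M, Q (P σ s)) →
      ∀ (u : Λ L M → ℝ),
        ‖Complex.exp (-(((K / 2 * ∑ s : Λ L M, Q (P σ s)) : ℝ) : ℂ)) *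
          (Complex.exp (-(((K / 2 * ∑ s : Λ L M, Q (P ((TorusChart.piProdZMod 2 L M).d₀ u) s)) : ℝ) : ℂ)) *
            ∏ s : Λ L M, Complex.exp
              (-((K : ℂ) * genF c (P (fun x i => (TorusChart.piProdZMod 2 L M).d₀ u x i - σ x i) s))
                + (((K / 2 * Q (P (fun x i => (TorusChart.piProdZMod 2 L M).d₀ u x i - σ x i) s)) : ℝ) : ℂ)))‖ ≤
          Real.exp (-(2 * c₀ * K / Real.pi ^ 2) * ∑ s : Λ L M, ∑ w : W r, ∑ w' : W r,
            (toIocMod Real.two_pi_pos (-Real.pi)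
              (P (fun x i => (TorusChart.piProdZMod 2 L M).d₀ u x i - σ x i) s w
                - P (fun x i => (TorusChart.piProdZMod 2 L M).d₀ u x i - σ x i) s w')) ^ 2) := by
  intro r K c c₀ hc₀ hK hC L M _ _ P _hP Q _hQ σ hpyth u
  exact hsc_modulusCore K (∑ s : Λ L M, Q (P σ s)) (∑ s : Λ L M, Q (P ((TorusChart.piProdZMod 2 L M).d₀ u) s))
    (2 * c₀ * K / Real.pi ^ 2)
    (fun s => genF c (P (fun x i => (TorusChart.piProdZMod 2 L M).d₀ u x i - σ x i) s))
    (fun s => Q (P (fun x i => (TorusChart.piProdZMod 2 L M).d₀ u x i - σ x i) s))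
    (fun s => ∑ w : W r, ∑ w' : W r, (toIocMod Real.two_pi_pos (-Real.pi)
      (P (fun x i => (TorusChart.piProdZMod 2 L M).d₀ u x i - σ x i) s w
        - P (fun x i => (TorusChart.piProdZMod 2 L M).d₀ u x i - σ x i) s w')) ^ 2)
    (fun s => FatGaussian.stub_fatGaussianDomination r c₀ K c hc₀ hK hC _) (hpyth u)

end Summit.HubbardSuperconductivity.HubbardSuperconductivity.Theorems.FSUnfolding
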